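import Summits.QuantumFields.BalabanUV.T4Continuum.Spine.NE3.FrameNormalisationDefectSize
import Summits.QuantumFields.BalabanUV.T4Continuum.Spine.NE3.FrameNormalisationDefectLipschitz
import HarnessLib

/-!
# T⁴ programme, node NE3 — census R50 open half (M1), SEVENTH BRICK: the `δ`-framed one-step double-bar average is LIPSCHITZ in the twist — two gauges with `ε`-close covariant
# block oscillations at both endpoints of `c` give `δ`-framed averages `τβ²Λ(e^{4φ+3Λ}+e^{2φ+Λ})`-close, `Λ = (1+ρ∕(1−ρ))(1+t)ε` (`FrameNormalisationDefectLipschitzFramed`)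

Cell `pub-balaban-gaps` (track G2, seat ne3, generation 11), row NE3; census `HOME/ne/NE3.md` §4 R50, §17 (M1).  Composition of brick 6 (`FrameNormalisationDefectLipschitz.
norm_twistedSum_sub_twistedSum_le_gauge`: the twisted exponents of two gauges are `Λ`-close) with brick 2's generic three-factor estimate
(`FrameNormalisationDefectSize.norm_framed_sub_framed_le`): the one-step LIPSCHITZ LETTER of the map `v ↦ D_δ[v]` that the contraction of (M1) iterates through the levels.

* **`norm_framedDbavg_sub_framedDbavg_le`** — at an `L`-bond `c = ⟨q, q + Le_κ⟩`, for two gauges `v, v′` (same background `V₀`, same perturbation `V₁`): if at both endpoints the twisted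
  holonomies are within `t` of `1`, the inverse oscillations `δ^{-1}` of both gauges within `η` of `1` and `ε`-close, `t + (1+t)η ≤ ρ < 1`, the `v′`-twisted exponents have norm `≤ φ`,
  `‖Ṽ₁(c)‖ ≤ τ`, `‖V̄₀(c)^{±1}‖ ≤ β`, then **`‖D_δ[v](c) − D_δ[v′](c)‖ ≤ τβ²Λ(e^{4φ+3Λ} + e^{2φ+Λ})`**, `Λ := (1+ρ∕(1−ρ))(1+t)ε`.

HONEST FRAMING (page 1).  Elementary estimates on OUR objects (0 def, 0 sorry); the contraction through the `k` levels and the smooth interpolant are NOT done; nothing of Bałaban's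
asserted; **NE3 NOT proved**; `PairLandauGaugeB8Avg` and the covariant root NOT proved; spine PROVED 0∕9; finite T⁴ rung (B)+1 — NOT continuum YM on ℝ⁴, NOT infinite volume, NOT
mass gap, NOT `BetaPertH`, NOT Clay.  HONEST DEPENDENCY: continuum YM on T⁴ ⇐ BetaPertH ∧ nine spine estimates (0/9 proved); BetaPertH ⇐ (D1) ∧ (D4) ∧ CAP+tail; G-an2-4 gates
asym, D1 and NE2/3/4.  PLACEMENT: `Summits/QuantumFields/BalabanUV/T4Continuum/Spine/NE3/`; imports `FrameNormalisationDefectSize` and `FrameNormalisationDefectLipschitz`.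

References: [Balaban1985Averaging] T. Bałaban, *Averaging operations for lattice gauge theories*, CMP 98 (1985) 17–51: (57)–(59) p. 27, (62) p. 28, (82) p. 30, (89) p. 31.
-/

set_option autoImplicit false

open scoped BigOperators Matrix Matrix.Norms.L2Operator
open NormedSpace

namespace Summit.QuantumFields.BalabanUV.T4Continuum.NE3.FrameNormalisationDefectLipschitzFramed

open Literature.MathematicalPhysics.QuantumFieldTheory.Balaban1983to89
open B7Prop1Explicit B7Prop2Explicit MatrixLog
open B7Eq92Concrete (Rc Rc_apply tHol tild)
open NE3.FrameNormalisationDefectSize (norm_framed_sub_framed_le)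
open NE3.FrameNormalisationDefectLipschitz (norm_twistedSum_sub_twistedSum_le_gauge)

noncomputable section

variable {d : ℕ} {n : Type*} [Fintype n] [DecidableEq n]

/-- **THE `δ`-FRAMED ONE-STEP DOUBLE-BAR AVERAGE IS LIPSCHITZ IN THE TWIST**: `‖D_δ[v](c) − D_δ[v′](c)‖ ≤ τβ²Λ(e^{4φ+3Λ} + e^{2φ+Λ})`, `Λ = (1+ρ∕(1−ρ))(1+t)ε`, for two gauges
whose inverse covariant block oscillations at both endpoints of `c` are `ε`-close (brick 6 at `c₋` and `c₊`, then brick 2's generic estimate with the `v′`-twisted exponents in the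
role of the reference exponents). [folklore] -/
theorem norm_framedDbavg_sub_framedDbavg_le [Nonempty n] (L : ℕ) (V₀ V₁ : Site d → Fin d → (Matrix n n ℂ)ˣ) (v v' : Site d → (Matrix n n ℂ)ˣ) (q : Site d) (κ : Fin d)
    {t η ρ ε φ τ β : ℝ} (ht : 0 ≤ t) (hη : 0 ≤ η) (hε : 0 ≤ ε) (hρ : t + (1 + t) * η ≤ ρ) (hρ1 : ρ < 1) (hτ : 0 ≤ τ) (hβ : 0 ≤ β)
    (hT : ∀ (y : Site d) (r : Fin d → Fin L), (y = q ∨ y = q + (L : ℤ) • e κ) →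
      ‖((tHol V₀ V₁ y (treeWord (boxVec L r)) : (Matrix n n ℂ)ˣ) : Matrix n n ℂ) - 1‖ ≤ t)
    (ha : ∀ (y : Site d) (r : Fin d → Fin L), (y = q ∨ y = q + (L : ℤ) • e κ) →
      ‖(((((v y)⁻¹ * Rc (hol V₀ y (treeWord (boxVec L r))) (v (y + boxVec L r)))⁻¹ : (Matrix n n ℂ)ˣ)) : Matrix n n ℂ) - 1‖ ≤ η)
    (hb : ∀ (y : Site d) (r : Fin d → Fin L), (y = q ∨ y = q + (L : ℤ) • e κ) →
      ‖(((((v' y)⁻¹ * Rc (hol V₀ y (treeWord (boxVec L r))) (v' (y + boxVec L r)))⁻¹ : (Matrix n n ℂ)ˣ)) : Matrix n n ℂ) - 1‖ ≤ η)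
    (hab : ∀ (y : Site d) (r : Fin d → Fin L), (y = q ∨ y = q + (L : ℤ) • e κ) →
      ‖(((((v y)⁻¹ * Rc (hol V₀ y (treeWord (boxVec L r))) (v (y + boxVec L r)))⁻¹ : (Matrix n n ℂ)ˣ)) : Matrix n n ℂ)
        - (((((v' y)⁻¹ * Rc (hol V₀ y (treeWord (boxVec L r))) (v' (y + boxVec L r)))⁻¹ : (Matrix n n ℂ)ˣ)) : Matrix n n ℂ)‖ ≤ ε)
    (hφ : ∀ y : Site d, (y = q ∨ y = q + (L : ℤ) • e κ) →
      ‖∑ r : Fin d → Fin L, (((L : ℝ) ^ d)⁻¹) •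
          mlog ((tHol V₀ V₁ y (treeWord (boxVec L r)) *
            ((v' y)⁻¹ * Rc (hol V₀ y (treeWord (boxVec L r))) (v' (y + boxVec L r)))⁻¹ : (Matrix n n ℂ)ˣ) : Matrix n n ℂ)‖ ≤ φ)
    (htild : ‖((tild L V₀ V₁ q κ : (Matrix n n ℂ)ˣ) : Matrix n n ℂ)‖ ≤ τ)
    (hbavg : ‖((bavg L V₀ q κ : (Matrix n n ℂ)ˣ) : Matrix n n ℂ)‖ ≤ β) (hbavgI : ‖(((bavg L V₀ q κ)⁻¹ : (Matrix n n ℂ)ˣ) : Matrix n n ℂ)‖ ≤ β) :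
    ‖(exp (-(∑ r : Fin d → Fin L, (((L : ℝ) ^ d)⁻¹) •
            mlog ((tHol V₀ V₁ q (treeWord (boxVec L r)) *
              ((v q)⁻¹ * Rc (hol V₀ q (treeWord (boxVec L r))) (v (q + boxVec L r)))⁻¹ : (Matrix n n ℂ)ˣ) : Matrix n n ℂ))) *
          ((tild L V₀ V₁ q κ : (Matrix n n ℂ)ˣ) : Matrix n n ℂ) *
          (((bavg L V₀ q κ : (Matrix n n ℂ)ˣ) : Matrix n n ℂ) *
            exp (∑ r : Fin d → Fin L, (((L : ℝ) ^ d)⁻¹) •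
              mlog ((tHol V₀ V₁ (q + (L : ℤ) • e κ) (treeWord (boxVec L r)) *
                ((v (q + (L : ℤ) • e κ))⁻¹ * Rc (hol V₀ (q + (L : ℤ) • e κ) (treeWord (boxVec L r)))
                  (v (q + (L : ℤ) • e κ + boxVec L r)))⁻¹ : (Matrix n n ℂ)ˣ) : Matrix n n ℂ)) *
            (((bavg L V₀ q κ)⁻¹ : (Matrix n n ℂ)ˣ) : Matrix n n ℂ)))
      - (exp (-(∑ r : Fin d → Fin L, (((L : ℝ) ^ d)⁻¹) •
            mlog ((tHol V₀ V₁ q (treeWord (boxVec L r)) *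
              ((v' q)⁻¹ * Rc (hol V₀ q (treeWord (boxVec L r))) (v' (q + boxVec L r)))⁻¹ : (Matrix n n ℂ)ˣ) : Matrix n n ℂ))) *
          ((tild L V₀ V₁ q κ : (Matrix n n ℂ)ˣ) : Matrix n n ℂ) *
          (((bavg L V₀ q κ : (Matrix n n ℂ)ˣ) : Matrix n n ℂ) *
            exp (∑ r : Fin d → Fin L, (((L : ℝ) ^ d)⁻¹) •
              mlog ((tHol V₀ V₁ (q + (L : ℤ) • e κ) (treeWord (boxVec L r)) *
                ((v' (q + (L : ℤ) • e κ))⁻¹ * Rc (hol V₀ (q + (L : ℤ) • e κ) (treeWord (boxVec L r)))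
                  (v' (q + (L : ℤ) • e κ + boxVec L r)))⁻¹ : (Matrix n n ℂ)ˣ) : Matrix n n ℂ)) *
            (((bavg L V₀ q κ)⁻¹ : (Matrix n n ℂ)ˣ) : Matrix n n ℂ)))‖
      ≤ τ * β ^ 2 * ((1 + ρ / (1 - ρ)) * ((1 + t) * ε)) *
          (Real.exp (4 * φ + 3 * ((1 + ρ / (1 - ρ)) * ((1 + t) * ε))) + Real.exp (2 * φ + (1 + ρ / (1 - ρ)) * ((1 + t) * ε))) := by
  have hm := norm_twistedSum_sub_twistedSum_le_gauge L V₀ V₁ v v' q ht hη hε hρ hρ1 (fun r => hT q r (Or.inl rfl)) (fun r => ha q r (Or.inl rfl))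
    (fun r => hb q r (Or.inl rfl)) (fun r => hab q r (Or.inl rfl))
  have hp := norm_twistedSum_sub_twistedSum_le_gauge L V₀ V₁ v v' (q + (L : ℤ) • e κ) ht hη hε hρ hρ1 (fun r => hT _ r (Or.inr rfl))
    (fun r => ha _ r (Or.inr rfl)) (fun r => hb _ r (Or.inr rfl)) (fun r => hab _ r (Or.inr rfl))
  exact norm_framed_sub_framed_le hτ hβ hm hp (hφ q (Or.inl rfl)) (hφ _ (Or.inr rfl)) htild hbavg hbavgI

end

end Summit.QuantumFields.BalabanUV.T4Continuum.NE3.FrameNormalisationDefectLipschitzFramed
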